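import Mathlib
import Literature.NumberTheory.Automorphic.KimExteriorSquareGL4
import Literature.NumberTheory.GaloisRepresentations.HeckeCharacter

/-!
# Asgari–Raghuram 2007, Theorem 1 (i) ⇒ (iii): if `∧²Π` is not cuspidal then `Π` is essentially
# self-dual or has a non-trivial self-twist (named fact, Satake form)

Topic `NumberTheory/Automorphic`; namespace `Literature.NumberTheory.Automorphic`.

Source (held, read at page level this session: `paper:arxiv-0712.4315`, p. 3 of the arXiv text):
M. Asgari, A. Raghuram, *A cuspidality criterion for the exterior square transfer of cusp forms
on GL(4)*, in: On certain L-functions (Purdue 2007), Clay Math. Proc. 13 (2011) 33–53 =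
arXiv:0712.4315 [AsgariRaghuram2007].

> **Theorem 1.** Let `F` be a number field and let `Π` be a cuspidal automorphic representation
> of `GL(4, 𝔸_F)`. The following are equivalent:
> (i) `∧²Π` is not cuspidal.
> (ii) `Π` is one of the following: (a) `Π = π₁ ⊠ π₂` …; (b) `Π = As(π)`, the Asai transfer of a
> dihedral cuspidal `π` of `GL(2, 𝔸_E)`, `E/F` quadratic; (c) `Π` is the functorial transfer of a
> (globally generic) cuspidal representation of `GSp(4, 𝔸_F)`; (d) `Π = I_E^F(π)`, the
> automorphic induction of a cuspidal `π` of `GL(2, 𝔸_E)`, `E/F` quadratic.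
> (iii) `Π` satisfies one of the following: (α) `Π ≅ Π̃ ⊗ χ` for some Hecke character `χ` of `F`,
> and `Π` is not the Asai transfer of a nondihedral cuspidal representation; (β) `Π ≅ Π ⊗ χ` for
> a nontrivial Hecke character `χ` of `F`.

Here `∧²Π` is Kim's exterior square transfer (JAMS 16 (2003), Thm. A; tree:
`Kim2003_exteriorSquare_GL4`, `wedgeTwoParams`): the unique isobaric automorphic representation
of `GL(6, 𝔸_F)` with `(∧²Π)_v = ∧²(Π_v)` at almost all places (p. 3: "the semi-simple conjugacy
class in `GL(6, ℂ)` determining `Σ_v` is generated by the image under `∧²` of the semi-simple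
conjugacy class in `GL(4, ℂ)` determining `Π_v`"; uniqueness by Jacquet–Shalika). The proof of
(i) ⇒ (iii) is §4, Props. 11–12 of the paper (Langlands–Shahidi method on `GSpin(2m+6)`, Kim's
lift, the Jacquet–Shalika classification); the descent results of Ginzburg–Rallis–Soudry enter
only (iii) ⇒ (ii), which is NOT vendored here.

## What is vendored, and why it is implied by the printed theorem

Only the implication **(i) ⇒ (iii)**, weakened by dropping the Asai exclusion in (α) (a
disjunct is only enlarged), and rendered on Satake parameters at almost all finite places — the
standing idiom of this topic (`GL4NonSelfDualIrreducible`, `KimExteriorSquareGL4`,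
`SelfdualGL3AdjointLift`): the tree pins automorphic representations of `GL_n(𝔸_F)` as
Borel–Jacquet data (`AutomorphicRepData`, `CuspidalAutomorphicRepData`) with unramified Hecke
eigenvalues (`HasSatakeParamAt`), and has no isobaric sums, contragredients or character twists
of such data.

* HYPOTHESIS "`∧²Π` is not cuspidal" is rendered as: *there is no cuspidal datum `Σ` on
  `GL(6, 𝔸_F)` whose Satake parameter at almost every finite `v` is `∧² t_{Π,v}`*
  (`wedgeTwoParams`). This IMPLIES the printed (i): were `∧²Π` cuspidal it would be such a `Σ`.
  (Conversely, by Jacquet–Shalika's strong multiplicity one for isobaric representations such a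
  cuspidal `Σ` equals `∧²Π`; not needed.)
* CONCLUSION (α) "`Π ≅ Π̃ ⊗ χ` for some Hecke character `χ`" is rendered by its unramified
  shadow: at almost every finite `v`, if `Π` has Satake parameter `α` at `v` then
  `{αᵢ⁻¹} = {χ(ϖ_v) αᵢ}` as multisets (`t_{Π̃,v} = t_{Π,v}⁻¹`, `t_{Π⊗χ,v} = χ(ϖ_v) t_{Π,v}` at
  the places where `Π_v` and `χ_v` are unramified — all but finitely many,
  `HeckeCharacter.isUnramifiedAt_cofinite`); `χ(ϖ_v)` is `HeckeCharacter.valueAtUniformizer`.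
* CONCLUSION (β) "`Π ≅ Π ⊗ χ`, `χ ≠ 1`" likewise: `χ ≠ 1` in the group `HeckeCharacter F` and
  `{χ(ϖ_v) αᵢ} = {αᵢ}` at almost every `v`.

Each rendered conclusion is implied by the printed one and the rendered hypothesis implies the
printed one, so the `def` below is implied by Theorem 1 (with Kim's existence theorem, which the
printed statement presupposes); nothing is strengthened. AR's standing "cuspidal" carries no
unitarity normalisation issue: (i) and (iii) are invariant under `Π ↦ Π ⊗ |det|^s`.

Use (route ExteriorSquareAscent of summit Langlands, item `InducedSquareAscent` =
`Summit.Langlands.Langlands.Theses.ExteriorSquareAscent.InducedSquareAscent`, stmt-Langlands-18053;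
also the cuspidality of `∧²π` step of `ReducibleInducesSquare`, stmt-Langlands-18054): applied over
the auxiliary quadratic field `L` to `BC_L(π)`, whose exterior square `P ⊞ P^γ` is not cuspidal.
Bridges available in tree: Hecke character ↦ `GL(1)` datum with Satake parameter `{χ(ϖ_v)}`
(`exists_automorphicRepData_detTwist_glOne`, `AutomorphicRepData.hasSatakeParamAt_detTwist_glOne`,
`GLOneOfHeckeCharacterBJ`), and conversely `AutomorphicRepData.exists_heckeCharacter_glOne`.

## References

* [AsgariRaghuram2007] M. Asgari, A. Raghuram, arXiv:0712.4315 = Clay Math. Proc. 13 (2011)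
  33–53: Theorem 1 (p. 3 of the arXiv text), §4 Props. 11–12 (proof of (i) ⇒ (iii)).
* [Kim2002] H. H. Kim, J. Amer. Math. Soc. 16 (2003) 139–183, Theorem A (existence of `∧²Π`).
* H. Jacquet, J. Shalika, Amer. J. Math. 103 (1981), Thm. 4.4 (strong multiplicity one for
  isobaric representations). [JacquetShalikaAJM1981II]
-/

noncomputable section

open scoped Classical MatrixGroups
open IsDedekindDomain NumberField Filter

namespace Literature.NumberTheory.Automorphic

open Literature.NumberTheory.GaloisRepresentations

/-- **Asgari–Raghuram 2007, Theorem 1, (i) ⇒ (iii) (Satake form).** *Let `F` be a number field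
and `Π` a cuspidal automorphic representation of `GL(4, 𝔸_F)`. If `∧²Π` is not cuspidal, then
either `Π ≅ Π̃ ⊗ χ` for some Hecke character `χ` of `F`, or `Π ≅ Π ⊗ χ` for a nontrivial Hecke
character `χ` of `F`.* Rendering (module docstring): the hypothesis says that no cuspidal datum
on `GL(6, 𝔸_F)` has Satake parameter `∧² t_{Π,v}` (`wedgeTwoParams`) at almost every finite place;
the conclusions are the unramified shadows `t_{Π,v}⁻¹ = χ(ϖ_v) · t_{Π,v}`, resp.
`χ(ϖ_v) · t_{Π,v} = t_{Π,v}` with `χ ≠ 1`, as multisets at almost every finite `v`. The Asai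
exclusion of the printed (iii)(α) is dropped (weaker disjunct). `hF m` is the standing fact
`isCompact_glFiniteIntegralLevel m F`. Grounds the lever crux
`Summit.Langlands.Langlands.Theses.ExteriorSquareAscent.InducedSquareAscent` (applied to the base
change of `π` to the auxiliary quadratic field).
[cite: AsgariRaghuram2007, Theorem 1 (i) ⇒ (iii); §4, Props. 11–12] -/
def AsgariRaghuram2007_selfDual_or_selfTwist_of_wedgeTwo_not_cuspidal : Prop :=
  ∀ (F : Type) [Field F] [NumberField F] (hF : ∀ m : ℕ, isCompact_glFiniteIntegralLevel m F)
    (π : CuspidalAutomorphicRepData 4 F (hF 4)),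
    (¬ ∃ S : CuspidalAutomorphicRepData 6 F (hF 6),
        ∀ᶠ v : HeightOneSpectrum (𝓞 F) in cofinite, ∀ α : Multiset ℂ,
          π.1.HasSatakeParamAt v α → S.1.HasSatakeParamAt v (wedgeTwoParams α)) →
    (∃ χ : HeckeCharacter F,
        ∀ᶠ v : HeightOneSpectrum (𝓞 F) in cofinite, ∀ α : Multiset ℂ,
          π.1.HasSatakeParamAt v α →
            α.map (fun a => a⁻¹) = α.map (fun a => χ.valueAtUniformizer v * a)) ∨
    (∃ χ : HeckeCharacter F, χ ≠ 1 ∧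
        ∀ᶠ v : HeightOneSpectrum (𝓞 F) in cofinite, ∀ α : Multiset ℂ,
          π.1.HasSatakeParamAt v α →
            α.map (fun a => χ.valueAtUniformizer v * a) = α)

/-- Unfolding lemma (`Iff.rfl`), the text a prover takes as hypothesis
`(h : AsgariRaghuram2007_selfDual_or_selfTwist_of_wedgeTwo_not_cuspidal)`. [folklore] -/
theorem AsgariRaghuram2007_selfDual_or_selfTwist_of_wedgeTwo_not_cuspidal_iff :
    AsgariRaghuram2007_selfDual_or_selfTwist_of_wedgeTwo_not_cuspidal ↔
      ∀ (F : Type) [Field F] [NumberField F] (hF : ∀ m : ℕ, isCompact_glFiniteIntegralLevel m F)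
        (π : CuspidalAutomorphicRepData 4 F (hF 4)),
        (¬ ∃ S : CuspidalAutomorphicRepData 6 F (hF 6),
            ∀ᶠ v : HeightOneSpectrum (𝓞 F) in cofinite, ∀ α : Multiset ℂ,
              π.1.HasSatakeParamAt v α → S.1.HasSatakeParamAt v (wedgeTwoParams α)) →
        (∃ χ : HeckeCharacter F,
            ∀ᶠ v : HeightOneSpectrum (𝓞 F) in cofinite, ∀ α : Multiset ℂ,
              π.1.HasSatakeParamAt v α →
                α.map (fun a => a⁻¹) = α.map (fun a => χ.valueAtUniformizer v * a)) ∨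
        (∃ χ : HeckeCharacter F, χ ≠ 1 ∧
            ∀ᶠ v : HeightOneSpectrum (𝓞 F) in cofinite, ∀ α : Multiset ℂ,
              π.1.HasSatakeParamAt v α →
                α.map (fun a => χ.valueAtUniformizer v * a) = α) :=
  Iff.rfl

/-- **Contrapositive form: a cuspidal `Π` on `GL(4)` which is neither essentially self-dual nor
self-twisted at Satake level has a CUSPIDAL exterior square** — the direction used by Shavali
(arXiv:2603.19768, §4.2) and by the route item `ReducibleInducesSquare`. Pure logic from the
named fact. [cite: AsgariRaghuram2007, Theorem 1 (i) ⇒ (iii)] -/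
theorem exists_cuspidal_wedgeTwo_of_not_selfDual_of_not_selfTwist
    (h : AsgariRaghuram2007_selfDual_or_selfTwist_of_wedgeTwo_not_cuspidal)
    (F : Type) [Field F] [NumberField F] (hF : ∀ m : ℕ, isCompact_glFiniteIntegralLevel m F)
    (π : CuspidalAutomorphicRepData 4 F (hF 4))
    (hsd : ∀ χ : HeckeCharacter F,
      ¬ ∀ᶠ v : HeightOneSpectrum (𝓞 F) in cofinite, ∀ α : Multiset ℂ,
          π.1.HasSatakeParamAt v α →
            α.map (fun a => a⁻¹) = α.map (fun a => χ.valueAtUniformizer v * a))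
    (hst : ∀ χ : HeckeCharacter F, χ ≠ 1 →
      ¬ ∀ᶠ v : HeightOneSpectrum (𝓞 F) in cofinite, ∀ α : Multiset ℂ,
          π.1.HasSatakeParamAt v α →
            α.map (fun a => χ.valueAtUniformizer v * a) = α) :
    ∃ S : CuspidalAutomorphicRepData 6 F (hF 6),
      ∀ᶠ v : HeightOneSpectrum (𝓞 F) in cofinite, ∀ α : Multiset ℂ,
        π.1.HasSatakeParamAt v α → S.1.HasSatakeParamAt v (wedgeTwoParams α) := by
  by_contra hno
  rcases h F hF π hno with ⟨χ, hχ⟩ | ⟨χ, hχ1, hχ⟩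
  · exact hsd χ hχ
  · exact hst χ hχ1 hχ

end Literature.NumberTheory.Automorphic

end
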